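/-
Origin: expansion seat `prover-pub-hodgecm-mc-carch-1-g4-0`, handover #CA38 2026-08-20T09:03Z md5 f6d9bcb002f2 (235 l., 8 decls; NEW additive leaf; imports #CA37 (this kit) + installed RUN-45 #CA34 Model.ArchKTypeOfLineSection + installed RUN-45 binder-2 #74 Model.HypCensus.KappaIota; RUN 46; INSTALL after #CA37; drops with #CA37; cert certs/ax-ArchKTypeOfSigmaIotaVal-f6d9bcb002f2.log: rc 0 / 13 s / 0 warnings / 8/8 trio) (`HOME/mc/pub-hodgecm-mc-carch-1/pkg46/HodgeCM/Model/ArchKTypeOfSigmaIotaVal.lean`, md5 f6d9bcb002f2, 235 lines);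
landed by the second packager p2 gen 5 (p2-g5) in gate run 46 as `HodgeCM/Model/ArchKTypeOfSigmaIotaVal.lean` (verbatim).
-/
/-
Copyright (c) 2026. Released under Apache 2.0 license as described in the file LICENSE.
Cell pub-hodgecm, MODEL layer (construction prover mc-carch-1, gen 4), BINDER-OWNERS row 12 `C`, junction (C-Σ) at `v₁`, values:
binder-2's (V-val) `hκ` (rows 18/19) at the R1 pin.
-/
import Summits.HodgeConjecture.HodgeCM.Model.ArchKTypeOfSigmaIota
import Summits.HodgeConjecture.HodgeCM.Model.ArchKTypeOfLineSection
import Summits.HodgeConjecture.HodgeCM.Model.HypCensus.KappaIota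

/-!
# (C-Σ) at `v₁`, values: `Λ₀` at the exponent of record, the closed form of the letter character, (V-val) at the R1 pin

Continuing `ArchKTypeOfSigmaIota` (§ 1–§ 2: `pinLetterChar (kVLetters (mulSingle v₁ x)) = Λ₀(u_x) · vacScalar e₀ (letterK x) · vacScalar e₁ (letterK x)`):

* § 3 `defLambdaChar_cmPlace_uOfLetter`: `Λ₀(u_x) = tw(det A · det D)^ℓ` at #CA29's exponent of record `ℓ = lambdaExponent` — the one-place
  element of a `v₁`-letter IS the `ι₁`-section of the ball projection of its `K_∞`-letter (`archSingle_uOfLetter_cmPlace_eq_archSectionFrameOf`,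
  binder-2 #62 `coe_archAt_cmPlaceOver_archFrameConj` read twice), then #CA29 `lambdaChar_stabilizer`, #CA34 `det_mat_stabilizer`,
  binder-2 #74 `det_coe_uOfLetter_cmPlace` / `det_coe_uOfLetter`;
* § 4 the closed form **`pinLetterChar_kVLetters_mulSingle_cmPlace`**:
  `pinLetterChar (kVLetters (mulSingle v₁ (A, D))) = tw(det A·det D)^ℓ · (det A^{e_P⁰} det D^{e_Q⁰}) · (det A^{e_P¹} det D^{e_Q¹})`, and
  **`hκ₁_R1` / `hκ_R1`**: binder-2's (V-val) residual `hκ₁` (#74 `hκ₁_iff_letterChar`) and the full `hκ` of rows 18/19 (#73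
  `hκ_of_iota_of_type` + #CA36 `nVR_eq_neg_pairVacExponent`) are THEOREMS for `χ_V` of the read-off type `nVR` (at the R1 pin `χV := χVR`,
  #CA35 `hasArchType_χVR_of_GOG`), any `χ_W`, under E's guard `(mk ι₁).embedding = ι₁` — the bookkeeping closes by the lines' pinned
  differences `e_P − e_Q = 1` (`lineVacExponentsZero/One_eP_sub_eQ`) and `dVIota = det A` in the positive `W`-reading forced by `hpos₀ hpos₁`.

0 records, 0 `def … : Prop`, nothing cited as a hypothesis.
-/

set_option autoImplicit false

noncomputable section

open NumberField NumberField.InfinitePlace NumberField.mixedEmbedding IsDedekindDomain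
open scoped Matrix Classical TensorProduct
open ComplexConjugate MvPolynomial
open Literature.NumberTheory.Automorphic Literature.NumberTheory.Automorphic.UnitaryGroup Literature.NumberTheory.Weil1964
open Literature.NumberTheory.GelbartRogawski1991 Literature.NumberTheory.GelbartRogawski1991.UnitaryDualPair
open Literature.RepresentationTheory.KonnoKonno2007 Literature.RepresentationTheory.KonnoKonno2007.RealDualPair
open Literature.RepresentationTheory (atPlace)
open Literature.Analysis.SegalBargmann
open HodgeCM.Adelic HodgeCM.PerL34 HodgeCM.Model.HypCensus HodgeCM.Model.ArchSideTerm HodgeCM.Model.SupplyInstance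

namespace HodgeCM.Model

/-! ## § 3 The see-saw discrepancy `Λ₀` on a `v₁`-letter is `(det A · det D)^ℓ` at the exponent OF RECORD -/

section Lambda

open Literature.Geometry.ComplexHyperbolic.BallModel (U21 x₀ mat)

variable {L : CMField} {ι₁ : L →+* ℂ} (V : HermSpace3 L ι₁) (S : StubTree.SeesawDatum L)
variable
  (hGR : (cmSplittingDatum (L : Type) finProdFinEquiv (frameD V) (frameD_real V) (frameD_ne V) (dW S) (dW_real S) (dW_ne S)).CompatibleSplitting)
  (hGR₀ : (cmSplittingDatum (L : Type) (e₁) (frameD V) (frameD_real V) (frameD_ne V) (lineVec (L : Type) (dW S 0))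
    (fun _ => dW_real S 0) (fun _ => dW_ne S 0)).CompatibleSplitting)
  (hGR₁ : (cmSplittingDatum (L : Type) (e₁) (frameD V) (frameD_real V) (frameD_ne V) (lineVec (L : Type) (dW S 1))
    (fun _ => dW_real S 1) (fun _ => dW_ne S 1)).CompatibleSplitting)
  (h₁W : (∀ j, 0 < (ι₁ (dW S j)).re) ∨ ∀ j, (ι₁ (dW S j)).re < 0)

/-- **an element of `U(diag d_V)(L ⊗ ℝ)` of the form `frameG⁻¹ k frameG` supported at `w(ι₁)` IS the `ι₁`-section of its ball
projection** (both have the `w(ι₁)`-matrix `(D_s · tw(π k) · D_s⁻¹)^{σ⁻¹,σ⁻¹}`, binder-2 #62, and are trivial elsewhere). -/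
theorem archFrameConj_eq_archSectionFrameOf
    (k : UnitaryGroup.arch (↥(maximalRealSubfield L)) (L : Type) (IsCMField.complexConj L) 3 V.Hm)
    (hk : ∀ w : {w : InfinitePlace (L : Type) // w.IsComplex}, w ≠ cmPlaceOver (L : Type) (cmPlace (L : Type) ι₁) →
      UnitaryGroup.archAt (↥(maximalRealSubfield L)) L (IsCMField.complexConj L) 3 (Matrix.diagonal (frameD V)) w
        (NumberField.complexConj_smul_infinitePlace (L : Type) _) (IsCMField.complexConj_ne_one (L : Type))
        (archFrameConj (L : Type) 3 V.Hm (frameG V) (frameD V) (frame_congr V) k) = 1) :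
    archFrameConj (L : Type) 3 V.Hm (frameG V) (frameD V) (frame_congr V) k =
      archSectionFrameOf V (archProjU21EmbCM (L : Type) V.Hm ι₁ V.sylvesterFrame (sylvesterFrame_formCongr V) k) := by
  apply (archPiEquiv (↥(maximalRealSubfield L)) (L : Type) (IsCMField.complexConj L) 3 (Matrix.diagonal (frameD V))
    (IsCMField.complexConj_ne_one (L : Type)) (NumberField.complexConj_smul_infinitePlace (L : Type))).injective
  funext w
  rw [archPiEquiv_apply, archPiEquiv_apply]
  by_cases hw : w = cmPlaceOver (L : Type) (cmPlace (L : Type) ι₁)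
  · subst hw
    -- the section is `archFrameConj` of its own `ι₁`-section, whose ball projection is the same
    have hπ : archProjU21EmbCM (L : Type) V.Hm ι₁ V.sylvesterFrame (sylvesterFrame_formCongr V)
        (archSectionArchOf V (archProjU21EmbCM (L : Type) V.Hm ι₁ V.sylvesterFrame (sylvesterFrame_formCongr V) k)) =
          archProjU21EmbCM (L : Type) V.Hm ι₁ V.sylvesterFrame (sylvesterFrame_formCongr V) k := by
      have h := archProjU21EmbCM_archPart_archSectionU21CM (L : Type) ι₁ V.Hm V.sylvesterFrame (sylvesterFrame_J V)
        (archProjU21EmbCM (L : Type) V.Hm ι₁ V.sylvesterFrame (sylvesterFrame_formCongr V) k)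
      rw [← archToAdelic_archSectionArchOf, UnitaryGroup.archPart_archToAdelic] at h
      exact h
    apply Subtype.ext; apply Units.ext; ext i j
    rw [archSectionFrameOf_apply, ← archFrameConj_eq_archFrameCongr, coe_archAt_cmPlaceOver_archFrameConj,
      coe_archAt_cmPlaceOver_archFrameConj, hπ]
  · rw [hk w hw, archAt_archSectionFrameOf_of_ne V (fun h => hw (h.trans (cmPlaceOver_cmPlace_eq (L := L) (ι₁ := ι₁)).symm))]

/-- **the one-place element of a `v₁`-letter is the `ι₁`-section of the ball projection of its `K_∞`-letter.** -/
theorem archSingle_uOfLetter_cmPlace_eq_archSectionFrameOf (x : Matrix.unitaryGroup (PosIdx (cmXV (L : Type) (frameD V) (frameD_real V) ι₁ (cmPlace (L : Type) ι₁))) ℂ × Matrix.unitaryGroup (NegIdx (cmXV (L : Type) (frameD V) (frameD_real V) ι₁ (cmPlace (L : Type) ι₁))) ℂ) :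
    UnitaryGroup.archSingle (↥(maximalRealSubfield L)) L (IsCMField.complexConj L) 3 (Matrix.diagonal (frameD V))
        (IsCMField.complexConj_ne_one L) (NumberField.complexConj_smul_infinitePlace (L : Type)) (cmPlaceOver (L : Type) (cmPlace (L : Type) ι₁))
        (uOfLetter (L : Type) (frameD V) (frameD_real V) (frameD_ne V) (dW S) (dW_real S) (dW_ne S) ι₁ (cmPlace (L : Type) ι₁) x) =
      archSectionFrameOf V (archProjU21EmbCM (L : Type) V.Hm ι₁ V.sylvesterFrame (sylvesterFrame_formCongr V)
        (lettInvArch V S (Pi.mulSingle (cmPlace (L : Type) ι₁) x))) := by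
  have hE : UnitaryGroup.archSingle (↥(maximalRealSubfield L)) L (IsCMField.complexConj L) 3 (Matrix.diagonal (frameD V))
      (IsCMField.complexConj_ne_one L) (NumberField.complexConj_smul_infinitePlace (L : Type)) (cmPlaceOver (L : Type) (cmPlace (L : Type) ι₁))
      (uOfLetter (L : Type) (frameD V) (frameD_real V) (frameD_ne V) (dW S) (dW_real S) (dW_ne S) ι₁ (cmPlace (L : Type) ι₁) x) =
        archFrameConj (L : Type) 3 V.Hm (frameG V) (frameD V) (frame_congr V) (lettInvArch V S (Pi.mulSingle (cmPlace (L : Type) ι₁) x)) := by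
    rw [archFrameConj_lettInvArch]
    exact (congrArg Prod.fst (letterSection_kVLetters_mulSingle V S (cmPlace (L : Type) ι₁) x)).symm
  rw [hE]
  refine archFrameConj_eq_archSectionFrameOf V _ fun w hw => ?_
  rw [← hE, UnitaryGroup.archAt_archSingle_of_ne _ _ _ _ _ _ _ _ hw]

/-- **`Λ₀` ON A `v₁`-LETTER**: the see-saw discrepancy `defLambdaChar … v₁` at `u_x` is `tw(det A · det D)^ℓ`, `ℓ = lambdaExponent`
the exponent of record (#CA29), `tw = embTwist L ι₁` (the identity under E's guard `(mk ι₁).embedding = ι₁`). -/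
theorem defLambdaChar_cmPlace_uOfLetter (x : Matrix.unitaryGroup (PosIdx (cmXV (L : Type) (frameD V) (frameD_real V) ι₁ (cmPlace (L : Type) ι₁))) ℂ × Matrix.unitaryGroup (NegIdx (cmXV (L : Type) (frameD V) (frameD_real V) ι₁ (cmPlace (L : Type) ι₁))) ℂ) :
    ((defLambdaChar V S hGR hGR₀ hGR₁ (cmPlace (L : Type) ι₁)
        (uOfLetter (L : Type) (frameD V) (frameD_real V) (frameD_ne V) (dW S) (dW_real S) (dW_ne S) ι₁ (cmPlace (L : Type) ι₁) x) : ℂˣ) : ℂ) =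
      embTwist (L : Type) ι₁
          ((x.1 : Matrix (PosIdx (cmXV (L : Type) (frameD V) (frameD_real V) ι₁ (cmPlace (L : Type) ι₁))) (PosIdx (cmXV (L : Type) (frameD V) (frameD_real V) ι₁ (cmPlace (L : Type) ι₁))) ℂ).det * (x.2 : Matrix (NegIdx (cmXV (L : Type) (frameD V) (frameD_real V) ι₁ (cmPlace (L : Type) ι₁))) (NegIdx (cmXV (L : Type) (frameD V) (frameD_real V) ι₁ (cmPlace (L : Type) ι₁))) ℂ).det) ^ lambdaExponent V S hGR hGR₀ hGR₁ h₁W := by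
  have hmem : archProjU21EmbCM (L : Type) V.Hm ι₁ V.sylvesterFrame (sylvesterFrame_formCongr V)
      (lettInvArch V S (Pi.mulSingle (cmPlace (L : Type) ι₁) x)) ∈ MulAction.stabilizer U21 x₀ :=
    Subgroup.mem_comap.mp (lettInvArch_mem V S (Pi.mulSingle (cmPlace (L : Type) ι₁) x))
  rw [defLambdaChar_apply, archSingle_uOfLetter_cmPlace_eq_archSectionFrameOf V S x, ← lambdaChar_apply V S hGR hGR₀ hGR₁,
    show archProjU21EmbCM (L : Type) V.Hm ι₁ V.sylvesterFrame (sylvesterFrame_formCongr V)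
      (lettInvArch V S (Pi.mulSingle (cmPlace (L : Type) ι₁) x)) = ((⟨_, hmem⟩ : MulAction.stabilizer U21 x₀) : U21) from rfl,
    lambdaChar_stabilizer V S hGR hGR₀ hGR₁ h₁W, ← det_mat_stabilizer]
  congr 1
  have h1 := det_coe_uOfLetter_cmPlace V S x
  rw [det_coe_uOfLetter] at h1
  have h2 := congrArg (embTwist (L : Type) ι₁) h1
  rw [embTwist_embTwist] at h2
  exact h2.symm

end Lambda

/-! ## § 4 The closed form, and (V-val) at the `ι₁` slot AT THE R1 PIN -/

section Scalar

/-- the exponent bookkeeping of `hκ₁` at the R1 pin: `(ab)^n · ((ab)^ℓ · a^{p₀} b^{q₀} · a^{p₁} b^{q₁}) · a = a b / b³` when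
`n = −p₀ − p₁ − ℓ` and `pₖ − qₖ = 1`. -/
theorem iota_bookkeeping {a b : ℂ} (ha : a ≠ 0) (hb : b ≠ 0) {n ℓ p₀ q₀ p₁ q₁ : ℤ} (hn : n = -p₀ - p₁ - ℓ)
    (h₀ : p₀ - q₀ = 1) (h₁ : p₁ - q₁ = 1) :
    (a * b) ^ n * ((a * b) ^ ℓ * (a ^ p₀ * b ^ q₀) * (a ^ p₁ * b ^ q₁)) * a = a * b / b ^ 3 := by
  have hab : a * b ≠ 0 := mul_ne_zero ha hb
  have hL : (a * b) ^ n * ((a * b) ^ ℓ * (a ^ p₀ * b ^ q₀) * (a ^ p₁ * b ^ q₁)) * a =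
      a ^ (n + ℓ + p₀ + p₁ + 1) * b ^ (n + ℓ + q₀ + q₁) := by
    rw [mul_zpow, mul_zpow, zpow_add₀ ha, zpow_add₀ ha, zpow_add₀ ha, zpow_add₀ ha, zpow_one, zpow_add₀ hb, zpow_add₀ hb,
      zpow_add₀ hb]
    ring
  rw [hL, show n + ℓ + p₀ + p₁ + 1 = 1 by omega, show n + ℓ + q₀ + q₁ = -2 by omega, zpow_one, zpow_neg, div_eq_mul_inv]
  rw [show b ^ (3 : ℕ) = b * b ^ (2 : ℤ) by rw [zpow_two, pow_succ, pow_two]; ring, mul_inv, ← mul_assoc, mul_assoc a b,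
    mul_inv_cancel₀ hb, mul_one]

end Scalar

section Final

variable {L : CMField} {ι₁ : L →+* ℂ} (V : HermSpace3 L ι₁) (c : SeesawCtx L)
variable
  (hGR : (cmSplittingDatum (L : Type) finProdFinEquiv (frameD V) (frameD_real V) (frameD_ne V) (dW c.D) (dW_real c.D) (dW_ne c.D)).CompatibleSplitting)
  (hGR₀ : (cmSplittingDatum (L : Type) (e₁) (frameD V) (frameD_real V) (frameD_ne V) (lineVec (L : Type) (dW c.D 0))
    (fun _ => dW_real c.D 0) (fun _ => dW_ne c.D 0)).CompatibleSplitting)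
  (hGR₁ : (cmSplittingDatum (L : Type) (e₁) (frameD V) (frameD_real V) (frameD_ne V) (lineVec (L : Type) (dW c.D 1))
    (fun _ => dW_real c.D 1) (fun _ => dW_ne c.D 1)).CompatibleSplitting)
  (h₁W : (∀ j, 0 < (ι₁ (dW c.D j)).re) ∨ ∀ j, (ι₁ (dW c.D j)).re < 0)
  (hpos₀ : 0 < cmXW (L : Type) (frameD V) (lineVec (L : Type) (dW c.D 0)) (fun _ => dW_real c.D 0) ι₁ (HypCensus.cmPlace (L : Type) ι₁) 0)
  (hpos₁ : 0 < cmXW (L : Type) (frameD V) (lineVec (L : Type) (dW c.D 1)) (fun _ => dW_real c.D 1) ι₁ (HypCensus.cmPlace (L : Type) ι₁) 0)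

/-- **THE PIN'S LETTER CHARACTER ON A `v₁`-LETTER, CLOSED FORM**:
`pinLetterChar (kVLetters (mulSingle v₁ (A, D))) = tw(det A·det D)^ℓ · (det A^{e_P⁰} det D^{e_Q⁰}) · (det A^{e_P¹} det D^{e_Q¹})`. -/
theorem pinLetterChar_kVLetters_mulSingle_cmPlace (x : Matrix.unitaryGroup (PosIdx (cmXV (L : Type) (frameD V) (frameD_real V) ι₁ (cmPlace (L : Type) ι₁))) ℂ × Matrix.unitaryGroup (NegIdx (cmXV (L : Type) (frameD V) (frameD_real V) ι₁ (cmPlace (L : Type) ι₁))) ℂ) :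
    ((pinLetterChar V c.D hGR h₁W (kVLetters V c.D (Pi.mulSingle (cmPlace (L : Type) ι₁) x)) : Circle) : ℂ) =
      embTwist (L : Type) ι₁ (((x.1 : Matrix.unitaryGroup (PosIdx (cmXV (L : Type) (frameD V) (frameD_real V) ι₁ (cmPlace (L : Type) ι₁))) ℂ) : Matrix (PosIdx (cmXV (L : Type) (frameD V) (frameD_real V) ι₁ (cmPlace (L : Type) ι₁))) (PosIdx (cmXV (L : Type) (frameD V) (frameD_real V) ι₁ (cmPlace (L : Type) ι₁))) ℂ).det * ((x.2 : Matrix.unitaryGroup (NegIdx (cmXV (L : Type) (frameD V) (frameD_real V) ι₁ (cmPlace (L : Type) ι₁))) ℂ) : Matrix (NegIdx (cmXV (L : Type) (frameD V) (frameD_real V) ι₁ (cmPlace (L : Type) ι₁))) (NegIdx (cmXV (L : Type) (frameD V) (frameD_real V) ι₁ (cmPlace (L : Type) ι₁))) ℂ).det) ^ lambdaExponent V c.D hGR hGR₀ hGR₁ h₁W *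
        (((x.1 : Matrix.unitaryGroup (PosIdx (cmXV (L : Type) (frameD V) (frameD_real V) ι₁ (cmPlace (L : Type) ι₁))) ℂ) : Matrix (PosIdx (cmXV (L : Type) (frameD V) (frameD_real V) ι₁ (cmPlace (L : Type) ι₁))) (PosIdx (cmXV (L : Type) (frameD V) (frameD_real V) ι₁ (cmPlace (L : Type) ι₁))) ℂ).det ^ (lineVacExponentsZero V c hGR₀ h₁W (posIdxEquivUnit hpos₀) (negIdxEquivEmpty hpos₀)).eP * ((x.2 : Matrix.unitaryGroup (NegIdx (cmXV (L : Type) (frameD V) (frameD_real V) ι₁ (cmPlace (L : Type) ι₁))) ℂ) : Matrix (NegIdx (cmXV (L : Type) (frameD V) (frameD_real V) ι₁ (cmPlace (L : Type) ι₁))) (NegIdx (cmXV (L : Type) (frameD V) (frameD_real V) ι₁ (cmPlace (L : Type) ι₁))) ℂ).det ^ (lineVacExponentsZero V c hGR₀ h₁W (posIdxEquivUnit hpos₀) (negIdxEquivEmpty hpos₀)).eQ) *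
        (((x.1 : Matrix.unitaryGroup (PosIdx (cmXV (L : Type) (frameD V) (frameD_real V) ι₁ (cmPlace (L : Type) ι₁))) ℂ) : Matrix (PosIdx (cmXV (L : Type) (frameD V) (frameD_real V) ι₁ (cmPlace (L : Type) ι₁))) (PosIdx (cmXV (L : Type) (frameD V) (frameD_real V) ι₁ (cmPlace (L : Type) ι₁))) ℂ).det ^ (lineVacExponentsOne V c hGR₁ h₁W (posIdxEquivUnit hpos₁) (negIdxEquivEmpty hpos₁)).eP * ((x.2 : Matrix.unitaryGroup (NegIdx (cmXV (L : Type) (frameD V) (frameD_real V) ι₁ (cmPlace (L : Type) ι₁))) ℂ) : Matrix (NegIdx (cmXV (L : Type) (frameD V) (frameD_real V) ι₁ (cmPlace (L : Type) ι₁))) (NegIdx (cmXV (L : Type) (frameD V) (frameD_real V) ι₁ (cmPlace (L : Type) ι₁))) ℂ).det ^ (lineVacExponentsOne V c hGR₁ h₁W (posIdxEquivUnit hpos₁) (negIdxEquivEmpty hpos₁)).eQ) := by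
  rw [pinLetterChar_kVLetters_mulSingle_cmPlace_eq V c hGR hGR₀ hGR₁ h₁W hpos₀ hpos₁, defLambdaChar_cmPlace_uOfLetter V c.D hGR hGR₀ hGR₁ h₁W,
    vacScalar_letterK, vacScalar_letterK]

variable (hemb : (InfinitePlace.mk ι₁).embedding = ι₁)
variable (χV χW : ContinuousMonoidHom
  (Literature.NumberTheory.Automorphic.relNormOneIdeles (↥(maximalRealSubfield L)) (L : Type) ⧸
    Literature.NumberTheory.Automorphic.relNormOneRat (↥(maximalRealSubfield L)) (L : Type)) Circle)

/-- the read-off table at the place over `v₁`: `nVR (w(v₁)) = nVR (mk ι₁) = −e_P⁰ − e_P¹ − ℓ`. -/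
theorem nVR_cmPlaceOver_cmPlace :
    nVR V c hGR hGR₀ hGR₁ h₁W hpos₀ hpos₁ (cmPlaceOver (L : Type) (cmPlace (L : Type) ι₁)).1 =
      -(lineVacExponentsZero V c hGR₀ h₁W (posIdxEquivUnit hpos₀) (negIdxEquivEmpty hpos₀)).eP - (lineVacExponentsOne V c hGR₁ h₁W (posIdxEquivUnit hpos₁) (negIdxEquivEmpty hpos₁)).eP - lambdaExponent V c.D hGR hGR₀ hGR₁ h₁W := by
  rw [cmPlaceOver_cmPlace_eq]
  exact nVR_mk V c hGR hGR₀ hGR₁ h₁W hpos₀ hpos₁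

include hemb hpos₀ hpos₁ hGR₀ hGR₁ in
/-- **(V-val) AT THE `ι₁` SLOT HOLDS AT THE R1 PIN.**  For `χ_V` of the read-off type `nVR` (#CA33; at the pin `χV := χVR`, #CA35
`hasArchType_χVR_of_GOG`), any `χ_W`, under E's guard `(mk ι₁).embedding = ι₁` (the lines' positivity `hpos₀ hpos₁` IS the positive
`W`-reading at `v₁`), binder-2's residual
`hκ₁` of #73 — `η(kPair k) · pinLetterChar (kVLetters (lett k)) · dVIota (lett k v₁) = archKappa k` on the `ι₁`-letters — is a THEOREM:
#74 `hκ₁_iff_letterChar` + the closed form above + `dVIota = det A` + the lines' pinned differences `e_P − e_Q = 1`. -/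
theorem hκ₁_R1 {nV : InfinitePlace (L : Type) → ℤ} (hnV : UnitaryLineChar.HasArchType (L : Type) χV nV)
    (hn : nV = nVR V c hGR hGR₀ hGR₁ h₁W hpos₀ hpos₁) :
    ∀ x : Matrix.unitaryGroup (PosIdx (cmXV (L : Type) (frameD V) (frameD_real V) ι₁ (cmPlace (L : Type) ι₁))) ℂ × Matrix.unitaryGroup (NegIdx (cmXV (L : Type) (frameD V) (frameD_real V) ι₁ (cmPlace (L : Type) ι₁))) ℂ,
      ((cmDetTwistChar (L : Type) (frameD V) (frameD_ne V) (dW c.D) (dW_ne c.D) (charOfUnitaryLineChar (L : Type) χV)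
            (charOfUnitaryLineChar (L : Type) χW)
            (kPair V c.D ι₁ V.sylvesterFrame (sylvesterFrame_formCongr V)
              (lettInv V c.D (Pi.mulSingle (cmPlace (L : Type) ι₁) x))) : ℂˣ) : ℂ) *
          ((pinLetterChar V c.D hGR h₁W (kVLetters V c.D (Pi.mulSingle (cmPlace (L : Type) ι₁) x)) : Circle) : ℂ) * dVIota V c.D x =
        ((UnitaryGroup.archKappa (L : Type) V.Hm ι₁ V.sylvesterFrame (sylvesterFrame_formCongr V)
          (lettInv V c.D (Pi.mulSingle (cmPlace (L : Type) ι₁) x)) : ℂˣ) : ℂ) := by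
  subst hn
  have hR : ∀ j, 0 < cmXW (L : Type) (frameD V) (dW c.D) (dW_real c.D) ι₁ (cmPlace (L : Type) ι₁) j := fun j => by
    fin_cases j
    · exact hpos₀
    · exact hpos₁
  haveI : Subsingleton (NegIdx (cmXV (L : Type) (frameD V) (frameD_real V) ι₁ (cmPlace (L : Type) ι₁))) := (blockNegEquiv V).subsingleton
  refine (hκ₁_iff_letterChar V c.D hGR h₁W χV χW hnV ((blockNegEquiv V).symm ())).mpr fun x => ?_
  have hA : ((x.1 : Matrix.unitaryGroup (PosIdx (cmXV (L : Type) (frameD V) (frameD_real V) ι₁ (cmPlace (L : Type) ι₁))) ℂ) : Matrix (PosIdx (cmXV (L : Type) (frameD V) (frameD_real V) ι₁ (cmPlace (L : Type) ι₁))) (PosIdx (cmXV (L : Type) (frameD V) (frameD_real V) ι₁ (cmPlace (L : Type) ι₁))) ℂ).det ≠ 0 := (Matrix.UnitaryGroup.det_isUnit x.1).ne_zero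
  have hD : ((x.2 : Matrix.unitaryGroup (NegIdx (cmXV (L : Type) (frameD V) (frameD_real V) ι₁ (cmPlace (L : Type) ι₁))) ℂ) : Matrix (NegIdx (cmXV (L : Type) (frameD V) (frameD_real V) ι₁ (cmPlace (L : Type) ι₁))) (NegIdx (cmXV (L : Type) (frameD V) (frameD_real V) ι₁ (cmPlace (L : Type) ι₁))) ℂ).det ≠ 0 := (Matrix.UnitaryGroup.det_isUnit x.2).ne_zero
  rw [pinLetterChar_kVLetters_mulSingle_cmPlace V c hGR hGR₀ hGR₁ h₁W hpos₀ hpos₁, nVR_cmPlaceOver_cmPlace V c hGR hGR₀ hGR₁ h₁W hpos₀ hpos₁,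
    dVIota_eq_det_of_pos V c.D hR,
    show vcMatrix (iotaFrameA (L : Type) (frameD V) (frameD_real V) ι₁ (frameD_sign_ι₁ V)) ((x.1 : Matrix.unitaryGroup (PosIdx (cmXV (L : Type) (frameD V) (frameD_real V) ι₁ (cmPlace (L : Type) ι₁))) ℂ) : Matrix (PosIdx (cmXV (L : Type) (frameD V) (frameD_real V) ι₁ (cmPlace (L : Type) ι₁))) (PosIdx (cmXV (L : Type) (frameD V) (frameD_real V) ι₁ (cmPlace (L : Type) ι₁))) ℂ) =
      (((x.1 : Matrix.unitaryGroup (PosIdx (cmXV (L : Type) (frameD V) (frameD_real V) ι₁ (cmPlace (L : Type) ι₁))) ℂ) : Matrix (PosIdx (cmXV (L : Type) (frameD V) (frameD_real V) ι₁ (cmPlace (L : Type) ι₁))) (PosIdx (cmXV (L : Type) (frameD V) (frameD_real V) ι₁ (cmPlace (L : Type) ι₁))) ℂ).submatrix (iotaFrameA (L : Type) (frameD V) (frameD_real V) ι₁ (frameD_sign_ι₁ V))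
        (iotaFrameA (L : Type) (frameD V) (frameD_real V) ι₁ (frameD_sign_ι₁ V)))ᵀ from rfl,
    Matrix.det_transpose, Matrix.det_submatrix_equiv_self, embTwist_apply_of_eq (L : Type) ι₁ hemb, embTwist_apply_of_eq (L : Type) ι₁ hemb,
    ← Matrix.det_eq_elem_of_subsingleton ((x.2 : Matrix.unitaryGroup (NegIdx (cmXV (L : Type) (frameD V) (frameD_real V) ι₁ (cmPlace (L : Type) ι₁))) ℂ) : Matrix (NegIdx (cmXV (L : Type) (frameD V) (frameD_real V) ι₁ (cmPlace (L : Type) ι₁))) (NegIdx (cmXV (L : Type) (frameD V) (frameD_real V) ι₁ (cmPlace (L : Type) ι₁))) ℂ) ((blockNegEquiv V).symm ())]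
  exact iota_bookkeeping hA hD rfl (lineVacExponentsZero_eP_sub_eQ V c hGR₀ h₁W _ _) (lineVacExponentsOne_eP_sub_eQ V c hGR₁ h₁W _ _)

include hemb hpos₀ hpos₁ hGR₀ hGR₁ in
/-- **(V-val) HOLDS AT THE R1 PIN — binder-2's `hκ` (rows 18/19, #51/#61/#70/#71 VERBATIM) is a THEOREM for `χ_V` of the read-off type
`nVR`**: #73 `hκ_of_iota_of_type` fed with #CA36 `nVR_eq_neg_pairVacExponent` (every definite `b ≠ v₁`) and `hκ₁_R1` (the `ι₁` slot). -/
theorem hκ_R1 {nV : InfinitePlace (L : Type) → ℤ} (hnV : UnitaryLineChar.HasArchType (L : Type) χV nV)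
    (hn : nV = nVR V c hGR hGR₀ hGR₁ h₁W hpos₀ hpos₁) (k : ↥(KInfty V)) :
    ((cmDetTwistChar (L : Type) (frameD V) (frameD_ne V) (dW c.D) (dW_ne c.D) (charOfUnitaryLineChar (L : Type) χV)
          (charOfUnitaryLineChar (L : Type) χW) (kPair V c.D ι₁ V.sylvesterFrame (sylvesterFrame_formCongr V) k) : ℂˣ) : ℂ) *
        ((pinLetterChar V c.D hGR h₁W (kVLetters V c.D (lett V c.D k)) : Circle) : ℂ) * dVIota V c.D (lett V c.D k (cmPlace (L : Type) ι₁)) =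
      ((UnitaryGroup.archKappa (L : Type) V.Hm ι₁ V.sylvesterFrame (sylvesterFrame_formCongr V) k : ℂˣ) : ℂ) :=
  hκ_of_iota_of_type V c.D hGR h₁W χV χW hnV (fun b hb => by rw [hn]; exact nVR_eq_neg_pairVacExponent V c hGR hGR₀ hGR₁ h₁W hpos₀ hpos₁ hb)
    (hκ₁_R1 V c hGR hGR₀ hGR₁ h₁W hpos₀ hpos₁ hemb χV χW hnV hn) k

end Final

end HodgeCM.Model

end
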